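import Summits.QuantumFields.BalabanUV.T4Continuum.Support.InsertionChannelFamilyComplex
import Summits.QuantumFields.BalabanUV.T4Continuum.Support.OutputRateComplexSliceEnd

/-!
# InsertionChannelFamilyComplexSlice — the channel road carried to Road D, part 7: the owner's REAL-SLICE END on the complex two-row chart
# (`OutputRateComplexSliceEnd.ne5_of_pointwiseSlots_reIm_realSlice`, owner g36-a: W1 displayed on REAL points only + slice letters) with
# MI-3a (`hdamp`) DISCHARGED from row NE9's displayed channel letters on the DOUBLED chart (part 5's row-blind complex insertion)
# (cell `pub-balaban`, T⁴ fan-out; row NE5, node U3; `HOME/t4/formal/NE5/LEAVES.md` row O1-c follower; parts 1–6 = p228265 ∕ p228521 ∕ p229012 ∕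
# p229246 ∕ `InsertionChannelFamilyComplex` ∕ `…ComplexLinear`; owner g36-a = p229951; INTENT `HOME/CLAIMS.log` l.18625 + ADDENDUM at part 5's PROPOSED line)

Unit `b2b-balaban-t4-ne5-formalise-leaf-06` (NE5 formalisation swarm, leaf prover 06, gen 13).  Summits-side NEW WORK under the LEAN
PLACEMENT RULE (cell bookkeeping over ABSTRACT carriers; nothing of the manuscripts under audit is asserted; 0 cite tags; the only `def`s are
the three TOY data of §2; no `Prop`-valued fact minted).  HONEST FRAMING: rung (B)+1 of the FINITE-VOLUME T⁴ continuum programme — NOT infinite volume, NOT a mass gap,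
NOT the Clay problem, NOT a proof of NE5 (`T4OutputRate.NE5`, NOT PRINTED; cell GAPS G-t4-U3-1) nor of NE9; spine 0/9 unchanged; 0/12
leaves instantiated on Bałaban's concrete objects (O1 = the substrate cell, owner R34).  HONEST DEPENDENCY (cell line, verbatim): continuum
YM on T⁴ ⇐ BetaPertH ∧ nine spine estimates (0/9 proved); BetaPertH ⇐ (D1) ∧ (D4) ∧ CAP+tail; G-an2-4 gates asym, D1 and NE2/3/4.

WHAT ([folklore] composition BY NAME, NO estimate).  **`ne5_of_pointwiseSlots_reIm_realSlice_insAtC`** (difference-form slices) and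
**`ne5_of_pointwiseSlots_reIm_realSlice_each_insAtC`** (the seven-clause `_each` form the substrate's L-E12 inhabits) = the owner's g36-a ENDs with every
hypothesis VERBATIM IN TYPE except `hdamp`, REPLACED by `hinsC : P.insA = insAtOfChannelC T out` on the window + row NE9's displayed letters on the
doubled chart (`ChannelAdditive ∕ ChannelStepSum ∕ ChannelSizeAtStepNN univ T κ wt τ`, the weight dictionary `0 ≤ wt k (out w i) ≤
P.rHist (k+1)·F.wt i`, the profile `τ k j ≤ c·ω^{k−j}`, `0 ≤ c`, `0 < ω`) — part 5's `insertionDamped_pointwise_of_insAtC` (gain `√2·c∕ω`)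
⟹ LITERALLY `T4OutputRate.NE5 EA EB W κ θ₁ C₅` over the ORIGINAL carriers at the owner's degraded rate `θ₁ = θ^{1−λ(r)}` and constant, with
`c ↦ √2·c∕ω`.  On this road the NE5-own displayed binders left are: W1 on REAL points (`hreal`, rows NE2∕NE3 via the owner's readings) + the
slice letters (`hslice`), W2 (`henv`), W4 (`hins`), the representation ∕ admissibility identities, the decay bounds, the smallness; L09 ∕
MI-3a are READ from row NE9's channel letters (owner R30 (ii) ∕ R35 wording, now on the doubled complex chart — HONEST RIDER of part 5).
§2 KERNEL WITNESS of the located design point (toy channel on the doubled chart `ℕ × Fin 2` over the kernel's `toyCarriers`):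
`toy_read_insAt_row` — part 1's insertion of the two-row table of a complex family `ℰ` reads at `(u, j)` the REAL row `reIm j (ℰ g u 0)`
(row-DEPENDENT); `toy_read_insAtC` — part 5's row-blind complex insertion reads `ℰ g u 0` itself at BOTH rows.
NOT IN THIS FILE: no instance; no NE9 binder discharged; nothing of W1∕W2 touched.  Headline wording: «junction only»; never «leaf
instantiated».  NE5 NOT PROVED; NE9 NOT PROVED; spine 0/9; rung (B)+1 finite T⁴; NOT infinite volume ∕ mass gap ∕ Clay.
Axioms ⊆ {propext, Classical.choice, Quot.sound}.
-/

noncomputable section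

open scoped BigOperators
open Finset Function Metric Set Complex Real

namespace Summit.QuantumFields.BalabanUV.T4Continuum.InsertionChannelFamily

open Literature.MathematicalPhysics.QuantumFieldTheory.Balaban1983to89
open Literature.MathematicalPhysics.QuantumFieldTheory.Balaban1983to89.T4OutputRate (Carriers Functional NE5)
open Literature.MathematicalPhysics.QuantumFieldTheory.Balaban1983to89.T4InputCauchyRateData (StepModel tableA tableB)
open Literature.MathematicalPhysics.QuantumFieldTheory.Balaban1983to89.T4HistoryLipschitzRecursion
  (ChannelAdditive ChannelStepSum ChannelSizeAtStepNN)
open Summit.QuantumFields.BalabanUV.T4Continuum.B13HistDatum (HistFrame Hist)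
open Summit.QuantumFields.BalabanUV.T4Continuum.OutputRateFunctionalTablesPointwise (PointwiseSlots)
open Summit.QuantumFields.BalabanUV.T4Continuum.OutputRateFunctionalTablesComplex (reImTab)
open Summit.QuantumFields.BalabanUV.T4Continuum.OutputRateComplexSliceEnd
  (ne5_of_pointwiseSlots_reIm_realSlice ne5_of_pointwiseSlots_reIm_realSlice_each)

variable {C : Carriers} {𝒰 𝒱 ι : Type} {F : HistFrame C}
variable {T : ℕ → (ℕ → ℝ) → (𝒰 × Fin 2 → C.Dom → ℝ) → ι → ℝ} {out : 𝒰 × Fin 2 → F.Idx → ι}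
variable {Op : Type*} [NormedAddCommGroup Op] [NormedSpace ℂ Op] (P : PointwiseSlots C (𝒰 × Fin 2) Op (Hist F))

/-- [folklore] **END — THE OWNER's REAL-SLICE END ON ROAD D's COMPLEX CHART WITH MI-3a READ FROM ROW NE9's CHANNEL LETTERS**:
`OutputRateComplexSliceEnd.ne5_of_pointwiseSlots_reIm_realSlice` (W1 on REAL points + slice letters, difference form) with `hdamp`
DISCHARGED by part 5's `insertionDamped_pointwise_of_insAtC` for slots whose run-A insertion IS the row-blind complex channel insertion. -/
theorem ne5_of_pointwiseSlots_reIm_realSlice_insAtC [Nonempty 𝒰] {ℰA ℰB : (ℕ → ℝ) → 𝒰 → C.Dom → ℂ} {EA : Functional C C.BgA}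
    {EB : Functional C C.BgB} {W : Set (ℕ → ℝ)} {κ G E₀ δ δ' θ c ω B r : ℝ} {wt : ℕ → ι → ℝ} {τ : ℕ → ℕ → ℝ}
    {oA oB : (ℕ → ℝ) → ℕ → 𝒱 → Op} (e : 𝒰 × Fin 2 → 𝒱) {real : Set 𝒱}
    (hbdA : ∀ g ∈ W, ∀ k, BddAbove (Set.range fun w => ‖P.insA g k (tableA (reImTab (C := C) ℰA) g PUnit.unit) w‖))
    (hbdB : ∀ g ∈ W, ∀ k, BddAbove (Set.range fun w => ‖P.insB g k (tableB (reImTab (C := C) ℰB) g PUnit.unit) w‖))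
    (hrA : ∀ g ∈ W, ∀ (X : C.Dom) (u : 𝒰) (i : Fin 2), ℰA g u X =
      P.Out (C.scale X) (P.opA g (C.scale X) (u, i)) (P.insA g (C.scale X) (tableA (reImTab (C := C) ℰA) g PUnit.unit) (u, i)) X)
    (hrB : ∀ g ∈ W, ∀ (X : C.Dom) (u : 𝒰) (i : Fin 2), ℰB g u X =
      P.Out (C.scale X) (P.opB g (C.scale X) (u, i)) (P.insB g (C.scale X) (tableB (reImTab (C := C) ℰB) g PUnit.unit) (u, i)) X)
    (hbase : ∀ k, ∀ g ∈ W, ∀ w, (P.opB g k w, P.insB g k (tableB (reImTab (C := C) ℰB) g PUnit.unit) w) ∈ P.Base k g w)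
    (henv : ∀ k, ∀ g ∈ W, ∀ w, ∀ q ∈ P.Base k g w, ∀ X : C.Dom, C.scale X = k →
      DifferentiableOn ℂ (fun z : Op × Hist F => P.Out k z.1 z.2 X) (closedBall q.1 (P.rOp k) ×ˢ closedBall q.2 (P.rHist k)) ∧
        ∀ z ∈ closedBall q.1 (P.rOp k) ×ˢ closedBall q.2 (P.rHist k), ‖P.Out k z.1 z.2 X‖ ≤ G * Real.exp (-(κ * C.d X)))
    (hdA : ∀ g ∈ W, ∀ (u : 𝒰) (X : C.Dom), ‖ℰA g u X‖ ≤ G * Real.exp (-(κ * C.d X)))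
    (hdB : ∀ g ∈ W, ∀ (u : 𝒰) (X : C.Dom), ‖ℰB g u X‖ ≤ E₀ * Real.exp (-(κ * C.d X))) (hE₀ : E₀ ≤ G)
    (heA : ∀ g ∈ W, ∀ k w, P.opA g k w = oA g k (e w)) (heB : ∀ g ∈ W, ∀ k w, P.opB g k w = oB g k (e w))
    (hreal : ∀ k, ∀ g ∈ W, ∀ v ∈ real, ‖oA g k v - oB g k v‖ ≤ δ * θ ^ k * P.rOp k)
    (hslice : ∀ k, ∀ g ∈ W, ∀ w : 𝒰 × Fin 2, ∃ γ : ℂ → 𝒱, ∃ z₀ : ℂ, ‖z₀‖ ≤ r ∧ γ z₀ = e w ∧ (∀ x : ℝ, |x| < 1 → γ x ∈ real) ∧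
      DiffContOnCl ℂ (fun z => oA g k (γ z) - oB g k (γ z)) (ball 0 1) ∧
        ∀ z : ℂ, ‖z‖ ≤ 1 → ‖oA g k (γ z) - oB g k (γ z)‖ ≤ 2 * B * P.rOp k)
    (hδ0 : 0 ≤ δ) (hδB : δ ≤ 2 * B) (hθ0 : 0 ≤ θ) (hθ1 : θ ≤ 1) (hr0 : 0 ≤ r) (hr : r < 1)
    (hins : ∀ k, ∀ g ∈ W, ∀ (t : C.Dom × (𝒰 × Fin 2) → ℝ), (∀ Y w, |t (Y, w)| ≤ E₀ * Real.exp (-(κ * C.d Y))) →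
      ∀ w, ‖P.insA g k t w - P.insB g k t w‖ ≤ δ' * θ ^ k * P.rHist k)
    (hinsC : ∀ k, ∀ g ∈ W, ∀ (t : C.Dom × (𝒰 × Fin 2) → ℝ) (w : 𝒰 × Fin 2), P.insA g k t w = insAtOfChannelC T out g k t w)
    (hadd : ChannelAdditive (Set.univ : Set (𝒰 × Fin 2 → C.Dom → ℝ)) T)
    (hsum : ChannelStepSum (Set.univ : Set (𝒰 × Fin 2 → C.Dom → ℝ)) T)
    (hsize : ChannelSizeAtStepNN (Set.univ : Set (𝒰 × Fin 2 → C.Dom → ℝ)) T κ wt τ) (hwt0 : ∀ k w i, 0 ≤ wt k (out w i))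
    (hwt : ∀ k w i, wt k (out w i) ≤ P.rHist (k + 1) * F.wt i) (hτ : ∀ k j, j ≤ k → τ k j ≤ c * ω ^ (k - j))
    (hG : 0 ≤ G) (hδ' : 0 ≤ δ') (hc : 0 ≤ c) (hω : 0 < ω)
    (hsmall : (1 + 4 * G * (Real.sqrt 2 * c / ω)) * ω < θ ^ (1 - (2 / π * Real.arctan (2 * r / (1 - r ^ 2)))))
    (ι' : C.BgB → 𝒰) (hιA : ∀ g ∈ W, ∀ (U : C.BgB) (X : C.Dom), EA g (C.transport U) X = (ℰA g (ι' U) X).re)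
    (hιB : ∀ g ∈ W, ∀ (U : C.BgB) (X : C.Dom), EB g U X = (ℰB g (ι' U) X).re) :
    NE5 EA EB W κ (θ ^ (1 - (2 / π * Real.arctan (2 * r / (1 - r ^ 2)))))
      (4 * G * (δ ^ (1 - (2 / π * Real.arctan (2 * r / (1 - r ^ 2)))) * (2 * B) ^ (2 / π * Real.arctan (2 * r / (1 - r ^ 2))) + δ') *
          (θ ^ (1 - (2 / π * Real.arctan (2 * r / (1 - r ^ 2)))) - ω) /
        (θ ^ (1 - (2 / π * Real.arctan (2 * r / (1 - r ^ 2)))) - (1 + 4 * G * (Real.sqrt 2 * c / ω)) * ω)) :=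
  ne5_of_pointwiseSlots_reIm_realSlice P e hbdA hbdB hrA hrB hbase henv hdA hdB hE₀ heA heB hreal hslice hδ0 hδB hθ0 hθ1 hr0 hr hins
    (insertionDamped_pointwise_of_insAtC P hinsC hadd hsum hsize hwt0 hwt hτ hc hω) hG hδ'
    (div_nonneg (mul_nonneg (Real.sqrt_nonneg _) hc) hω.le) hω.le hsmall ι' hιA hιB

/-- [folklore] **END — THE SAME WITH THE TWO FAMILIES' SLICES HYPOTHESISED SEPARATELY** (the owner's `_each` seven-clause form — the shape
the substrate's L-E12 `hslice_sliceDisc₂_each` inhabits), `hdamp` discharged by part 5. -/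
theorem ne5_of_pointwiseSlots_reIm_realSlice_each_insAtC [Nonempty 𝒰] {ℰA ℰB : (ℕ → ℝ) → 𝒰 → C.Dom → ℂ} {EA : Functional C C.BgA}
    {EB : Functional C C.BgB} {W : Set (ℕ → ℝ)} {κ G E₀ δ δ' θ c ω B r : ℝ} {wt : ℕ → ι → ℝ} {τ : ℕ → ℕ → ℝ}
    {oA oB : (ℕ → ℝ) → ℕ → 𝒱 → Op} (e : 𝒰 × Fin 2 → 𝒱) {real : Set 𝒱}
    (hbdA : ∀ g ∈ W, ∀ k, BddAbove (Set.range fun w => ‖P.insA g k (tableA (reImTab (C := C) ℰA) g PUnit.unit) w‖))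
    (hbdB : ∀ g ∈ W, ∀ k, BddAbove (Set.range fun w => ‖P.insB g k (tableB (reImTab (C := C) ℰB) g PUnit.unit) w‖))
    (hrA : ∀ g ∈ W, ∀ (X : C.Dom) (u : 𝒰) (i : Fin 2), ℰA g u X =
      P.Out (C.scale X) (P.opA g (C.scale X) (u, i)) (P.insA g (C.scale X) (tableA (reImTab (C := C) ℰA) g PUnit.unit) (u, i)) X)
    (hrB : ∀ g ∈ W, ∀ (X : C.Dom) (u : 𝒰) (i : Fin 2), ℰB g u X =
      P.Out (C.scale X) (P.opB g (C.scale X) (u, i)) (P.insB g (C.scale X) (tableB (reImTab (C := C) ℰB) g PUnit.unit) (u, i)) X)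
    (hbase : ∀ k, ∀ g ∈ W, ∀ w, (P.opB g k w, P.insB g k (tableB (reImTab (C := C) ℰB) g PUnit.unit) w) ∈ P.Base k g w)
    (henv : ∀ k, ∀ g ∈ W, ∀ w, ∀ q ∈ P.Base k g w, ∀ X : C.Dom, C.scale X = k →
      DifferentiableOn ℂ (fun z : Op × Hist F => P.Out k z.1 z.2 X) (closedBall q.1 (P.rOp k) ×ˢ closedBall q.2 (P.rHist k)) ∧
        ∀ z ∈ closedBall q.1 (P.rOp k) ×ˢ closedBall q.2 (P.rHist k), ‖P.Out k z.1 z.2 X‖ ≤ G * Real.exp (-(κ * C.d X)))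
    (hdA : ∀ g ∈ W, ∀ (u : 𝒰) (X : C.Dom), ‖ℰA g u X‖ ≤ G * Real.exp (-(κ * C.d X)))
    (hdB : ∀ g ∈ W, ∀ (u : 𝒰) (X : C.Dom), ‖ℰB g u X‖ ≤ E₀ * Real.exp (-(κ * C.d X))) (hE₀ : E₀ ≤ G)
    (heA : ∀ g ∈ W, ∀ k w, P.opA g k w = oA g k (e w)) (heB : ∀ g ∈ W, ∀ k w, P.opB g k w = oB g k (e w))
    (hreal : ∀ k, ∀ g ∈ W, ∀ v ∈ real, ‖oA g k v - oB g k v‖ ≤ δ * θ ^ k * P.rOp k)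
    (hslice : ∀ k, ∀ g ∈ W, ∀ w : 𝒰 × Fin 2, ∃ γ : ℂ → 𝒱, ∃ z₀ : ℂ, ‖z₀‖ ≤ r ∧ γ z₀ = e w ∧ (∀ x : ℝ, |x| < 1 → γ x ∈ real) ∧
      DiffContOnCl ℂ (fun z => oA g k (γ z)) (ball 0 1) ∧ DiffContOnCl ℂ (fun z => oB g k (γ z)) (ball 0 1) ∧
        (∀ z : ℂ, ‖z‖ ≤ 1 → ‖oA g k (γ z)‖ ≤ B * P.rOp k) ∧ ∀ z : ℂ, ‖z‖ ≤ 1 → ‖oB g k (γ z)‖ ≤ B * P.rOp k)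
    (hδ0 : 0 ≤ δ) (hδB : δ ≤ 2 * B) (hθ0 : 0 ≤ θ) (hθ1 : θ ≤ 1) (hr0 : 0 ≤ r) (hr : r < 1)
    (hins : ∀ k, ∀ g ∈ W, ∀ (t : C.Dom × (𝒰 × Fin 2) → ℝ), (∀ Y w, |t (Y, w)| ≤ E₀ * Real.exp (-(κ * C.d Y))) →
      ∀ w, ‖P.insA g k t w - P.insB g k t w‖ ≤ δ' * θ ^ k * P.rHist k)
    (hinsC : ∀ k, ∀ g ∈ W, ∀ (t : C.Dom × (𝒰 × Fin 2) → ℝ) (w : 𝒰 × Fin 2), P.insA g k t w = insAtOfChannelC T out g k t w)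
    (hadd : ChannelAdditive (Set.univ : Set (𝒰 × Fin 2 → C.Dom → ℝ)) T)
    (hsum : ChannelStepSum (Set.univ : Set (𝒰 × Fin 2 → C.Dom → ℝ)) T)
    (hsize : ChannelSizeAtStepNN (Set.univ : Set (𝒰 × Fin 2 → C.Dom → ℝ)) T κ wt τ) (hwt0 : ∀ k w i, 0 ≤ wt k (out w i))
    (hwt : ∀ k w i, wt k (out w i) ≤ P.rHist (k + 1) * F.wt i) (hτ : ∀ k j, j ≤ k → τ k j ≤ c * ω ^ (k - j))
    (hG : 0 ≤ G) (hδ' : 0 ≤ δ') (hc : 0 ≤ c) (hω : 0 < ω)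
    (hsmall : (1 + 4 * G * (Real.sqrt 2 * c / ω)) * ω < θ ^ (1 - (2 / π * Real.arctan (2 * r / (1 - r ^ 2)))))
    (ι' : C.BgB → 𝒰) (hιA : ∀ g ∈ W, ∀ (U : C.BgB) (X : C.Dom), EA g (C.transport U) X = (ℰA g (ι' U) X).re)
    (hιB : ∀ g ∈ W, ∀ (U : C.BgB) (X : C.Dom), EB g U X = (ℰB g (ι' U) X).re) :
    NE5 EA EB W κ (θ ^ (1 - (2 / π * Real.arctan (2 * r / (1 - r ^ 2)))))
      (4 * G * (δ ^ (1 - (2 / π * Real.arctan (2 * r / (1 - r ^ 2)))) * (2 * B) ^ (2 / π * Real.arctan (2 * r / (1 - r ^ 2))) + δ') *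
          (θ ^ (1 - (2 / π * Real.arctan (2 * r / (1 - r ^ 2)))) - ω) /
        (θ ^ (1 - (2 / π * Real.arctan (2 * r / (1 - r ^ 2)))) - (1 + 4 * G * (Real.sqrt 2 * c / ω)) * ω)) :=
  ne5_of_pointwiseSlots_reIm_realSlice_each P e hbdA hbdB hrA hrB hbase henv hdA hdB hE₀ heA heB hreal hslice hδ0 hδB hθ0 hθ1 hr0 hr
    hins (insertionDamped_pointwise_of_insAtC P hinsC hadd hsum hsize hwt0 hwt hτ hc hω) hG hδ'
    (div_nonneg (mul_nonneg (Real.sqrt_nonneg _) hc) hω.le) hω.le hsmall ι' hιA hιB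

/-! ## §2 Kernel witness of the located design point: on the two-row chart the complex insertion READS THE COMPLEX TERM, part 1's
insertion reads ONE REAL ROW -/

section Toy

open Literature.MathematicalPhysics.QuantumFieldTheory.Balaban1983to89.T4InputCauchyRate (toyCarriers)
open Summit.QuantumFields.BalabanUV.T4Continuum.OutputRateFunctionalTablesFamily (toBgFamily)
open Summit.QuantumFields.BalabanUV.T4Continuum.OutputRateFunctionalTablesComplex (reIm)

/-- [folklore] Toy frame over the kernel's `toyCarriers` (domains = creation steps): one entry per domain, unit level formats. -/
abbrev toyFrame₂ : HistFrame toyCarriers where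
  Idx := ℕ
  dom n := n
  wt _ := 1
  wt_pos _ := one_pos

/-- [folklore] Toy channel on the DOUBLED chart `ℕ × Fin 2`: at step `k` the output index `(n, w)` reads the two-row family AT the row `w`
and the domain `n`, for `n ≤ k`. -/
def toyChannel₂ : ℕ → (ℕ → ℝ) → (ℕ × Fin 2 → toyCarriers.Dom → ℝ) → ℕ × (ℕ × Fin 2) → ℝ :=
  fun k _ H y => if y.1 ≤ k then H y.2 y.1 else 0

/-- [folklore] Toy output-index map on the doubled chart: the entry `n` at the row `w` reads the output index `(n, w)`. -/
def toyOut₂ : ℕ × Fin 2 → toyFrame₂.Idx → ℕ × (ℕ × Fin 2) := fun w n => (n, w)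

/-- [folklore] At step `0` the toy channel entries of the two-row table of ANY complex family at any row are level-bounded. -/
theorem toy₂_entries_bdd (ℰ : (ℕ → ℝ) → ℕ → toyCarriers.Dom → ℂ) (g : ℕ → ℝ) (w : ℕ × Fin 2) :
    ∃ μ : ℝ, ∀ n, ‖chanEntries (F := toyFrame₂) toyChannel₂ toyOut₂ 0 g (tableB (reImTab (C := toyCarriers) ℰ) g PUnit.unit) w n‖ ≤
      μ * toyFrame₂.wt n := by
  refine ⟨‖ℰ g w.1 (0 : ℕ)‖, fun n => ?_⟩
  show ‖(((if n ≤ 0 then reIm w.2 (ℰ g w.1 n) else 0 : ℝ)) : ℂ)‖ ≤ ‖ℰ g w.1 (0 : ℕ)‖ * 1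
  rw [Complex.norm_real, Real.norm_eq_abs, mul_one]
  by_cases h : n ≤ 0
  · rw [if_pos h, Nat.le_zero.1 h]
    exact OutputRateFunctionalTablesComplex.abs_reIm_le _ _
  · rw [if_neg h, abs_zero]; exact norm_nonneg _

/-- [folklore] **PART 1's INSERTION ON THE TWO-ROW CHART READS ONE REAL ROW** (the located design point, kernel-checked): inserting the
two-row table of a complex family `ℰ` at step `1`, the entry `0` at the chart point `(u, j)` is the REAL number `reIm j (ℰ g u (0 : ℕ))` —
`Re` at row `0`, `Im` at row `1`: row-DEPENDENT, never the complex value. -/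
theorem toy_read_insAt_row (ℰ : (ℕ → ℝ) → ℕ → toyCarriers.Dom → ℂ) (g : ℕ → ℝ) (u : ℕ) (j : Fin 2) :
    toyFrame₂.read (insAtOfChannel (F := toyFrame₂) toyChannel₂ toyOut₂ g 1 (tableB (reImTab (C := toyCarriers) ℰ) g PUnit.unit) (u, j)) 0 =
      ((reIm j (ℰ g u (0 : ℕ)) : ℝ) : ℂ) := by
  rw [read_insAt_succ (F := toyFrame₂) toyChannel₂ toyOut₂ (toy₂_entries_bdd ℰ g (u, j)) 0]
  rfl

/-- [folklore] **PART 5's ROW-BLIND COMPLEX INSERTION READS THE COMPLEX TERM** (kernel-checked): at either row of the chart point `u`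
the entry `0` IS `ℰ g u 0` — one complex history per complex point, as [II] (1.33) read at a complex background wants. -/
theorem toy_read_insAtC (ℰ : (ℕ → ℝ) → ℕ → toyCarriers.Dom → ℂ) (g : ℕ → ℝ) (u : ℕ) (j : Fin 2) :
    toyFrame₂.read (insAtOfChannelC (F := toyFrame₂) toyChannel₂ toyOut₂ g 1 (tableB (reImTab (C := toyCarriers) ℰ) g PUnit.unit) (u, j)) 0 =
      ℰ g u (0 : ℕ) := by
  rw [read_insAtC_succ (F := toyFrame₂) toyChannel₂ toyOut₂ (toy₂_entries_bdd ℰ g (u, 0)) (toy₂_entries_bdd ℰ g (u, 1)) j 0]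
  show (((if (0 : ℕ) ≤ 0 then reIm 0 (ℰ g u (0 : ℕ)) else 0 : ℝ)) : ℂ) + I * (((if (0 : ℕ) ≤ 0 then reIm 1 (ℰ g u (0 : ℕ)) else 0 : ℝ)) : ℂ) = ℰ g u (0 : ℕ)
  rw [if_pos le_rfl, if_pos le_rfl, OutputRateFunctionalTablesComplex.reIm_zero, OutputRateFunctionalTablesComplex.reIm_one, mul_comm,
    Complex.re_add_im]

end Toy

end Summit.QuantumFields.BalabanUV.T4Continuum.InsertionChannelFamily

end
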